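import Mathlib

/-!
# The Liouville flux field on the cube is divergence free (all dimensions `p = n + 2`)

Crux `MultiplicationAccessible`, line `shifted-family-prime-sieve`, design `GeneralPDesign.md` (route R2,
step A). On the open cube `(0,1)^p` put `T = ∏ tᵢ`, `ζ = T^(1/p)`, `C = ∏ (1 − tᵢ)^(s−1)`,
`M_k = t_k^x ∏_{j=1}^{p−1} t_{k+j}^(x + j/p − 1)` (cyclic indices) and the flux field
`Y_k = (1/p)(1 − t_k)(1 − ζ)^(−ps) C · M_k · ζ^(−px)`. Then `Σ_k ∂_k Y_k = 0`: the diagonal partials are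
`(s/p)(1 − ζ)^(−ps−1)(C/T)·ρ_k(ζ − t_k)` with `ρ_k = ∏_j t_{k+j}^(j/p)`, and `Σ_k ρ_k(ζ − t_k) = 0` is the cyclic
identity `ρ_k ζ = Q_k`, `ρ_k t_k = Q_{k+1}` for `Q_k = ∏_i t_{k+i}^((i+1)/p)`.
-/

noncomputable section

open Finset Real
open scoped BigOperators

namespace Summit.KontsevichZagierPeriods.TerasomaMultiplication.MultiplicationAccessible

namespace CornerField

variable {n : ℕ}

/-- Reindexing a product over `Fin (n+2)` by a translation. [folklore] -/
theorem prod_add_left (f : Fin (n + 2) → ℝ) (k : Fin (n + 2)) : ∏ i, f (k + i) = ∏ i, f i :=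
  Fintype.prod_equiv (Equiv.addLeft k) _ _ fun _ => rfl

/-- Index bookkeeping: `k + 1 + i.castSucc = k + i.succ`. [folklore] -/
theorem add_one_add_castSucc (k : Fin (n + 2)) (i : Fin (n + 1)) : k + 1 + Fin.castSucc i = k + i.succ := by
  rw [add_assoc, add_comm 1, Fin.coeSucc_eq_succ]

/-- Index bookkeeping: `k + 1 + last = k`. [folklore] -/
theorem add_one_add_last (k : Fin (n + 2)) : k + 1 + Fin.last (n + 1) = k := by
  rw [add_assoc, add_comm 1, Fin.last_add_one, add_zero]

/-- **The cyclic identity, first half**: `ρ_k · ζ = Q_k`. [folklore] -/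
theorem rho_mul_zeta (t : Fin (n + 2) → ℝ) (ht : ∀ i, 0 < t i) (k : Fin (n + 2)) :
    (∏ j : Fin (n + 1), t (k + j.succ) ^ ((((j:ℕ):ℝ) + 1) / ((n:ℝ) + 2))) *
        (∏ i, t i) ^ (1 / ((n:ℝ) + 2)) =
      ∏ i : Fin (n + 2), t (k + i) ^ ((((i:ℕ):ℝ) + 1) / ((n:ℝ) + 2)) := by
  have hζ : (∏ i, t i) ^ (1 / ((n:ℝ) + 2)) =
      t k ^ (1 / ((n:ℝ) + 2)) * ∏ j : Fin (n + 1), t (k + j.succ) ^ (1 / ((n:ℝ) + 2)) := by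
    rw [← Real.finsetProd_rpow _ _ (fun i _ => (ht i).le), ← prod_add_left (fun i => t i ^ (1 / ((n:ℝ) + 2))) k,
      Fin.prod_univ_succ]
    simp
  have hQ : ∏ i : Fin (n + 2), t (k + i) ^ ((((i:ℕ):ℝ) + 1) / ((n:ℝ) + 2)) =
      t k ^ (1 / ((n:ℝ) + 2)) * ∏ j : Fin (n + 1), t (k + j.succ) ^ ((((j:ℕ):ℝ) + 2) / ((n:ℝ) + 2)) := by
    rw [Fin.prod_univ_succ]
    simp only [Fin.val_zero, Nat.cast_zero, zero_add, Fin.val_succ, Nat.cast_add, Nat.cast_one, add_zero]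
    congr 2
    funext j
    congr 1
    ring
  rw [hζ, hQ, mul_left_comm, ← Finset.prod_mul_distrib]
  congr 1
  refine Finset.prod_congr rfl fun j _ => ?_
  rw [← Real.rpow_add (ht _)]
  congr 1
  ring

/-- **The cyclic identity, second half**: `ρ_k · t_k = Q_{k+1}`. [folklore] -/
theorem rho_mul_self (t : Fin (n + 2) → ℝ) (k : Fin (n + 2)) :
    (∏ j : Fin (n + 1), t (k + j.succ) ^ ((((j:ℕ):ℝ) + 1) / ((n:ℝ) + 2))) * t k =
      ∏ i : Fin (n + 2), t (k + 1 + i) ^ ((((i:ℕ):ℝ) + 1) / ((n:ℝ) + 2)) := by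
  conv_rhs => rw [Fin.prod_univ_castSucc]
  simp only [add_one_add_castSucc, add_one_add_last, Fin.val_castSucc, Fin.val_last, Nat.cast_add, Nat.cast_one]
  have hp : (((n:ℝ) + 1 + 1) / ((n:ℝ) + 2)) = 1 := by
    rw [div_eq_one_iff_eq (by positivity)]; ring
  rw [hp, Real.rpow_one]

/-- **`Σ_k ρ_k (ζ − t_k) = 0`** (telescoping over the cyclic group). [folklore] -/
theorem sum_rho_mul_sub (t : Fin (n + 2) → ℝ) (ht : ∀ i, 0 < t i) :
    ∑ k : Fin (n + 2), (∏ j : Fin (n + 1), t (k + j.succ) ^ ((((j:ℕ):ℝ) + 1) / ((n:ℝ) + 2))) *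
      ((∏ i, t i) ^ (1 / ((n:ℝ) + 2)) - t k) = 0 := by
  simp only [mul_sub, Finset.sum_sub_distrib, rho_mul_zeta t ht, rho_mul_self t]
  rw [sub_eq_zero]
  exact (Equiv.sum_comp (Equiv.addRight (1 : Fin (n + 2)))
    (fun k => ∏ i : Fin (n + 2), t (k + i) ^ ((((i:ℕ):ℝ) + 1) / ((n:ℝ) + 2)))).symm

/-- The translated successors exhaust the complement of `k`: `f k · ∏_j f (k + j.succ) = ∏_i f i`. [folklore] -/
theorem mul_prod_add_succ (f : Fin (n + 2) → ℝ) (k : Fin (n + 2)) :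
    f k * ∏ j : Fin (n + 1), f (k + j.succ) = ∏ i, f i := by
  rw [← prod_add_left f k, Fin.prod_univ_succ (fun i => f (k + i))]
  simp

/-- The index `k + j.succ` is never `k`. [folklore] -/
theorem add_succ_ne (k : Fin (n + 2)) (j : Fin (n + 1)) : k + j.succ ≠ k := by
  intro h
  exact Fin.succ_ne_zero j (add_eq_left.mp h)

end CornerField

open CornerField in
/-- **The Liouville flux field is divergence free** (all `p = n + 2`): with `ζ = (∏t)^(1/p)`,
`C = ∏(1 − tᵢ)^(s−1)`, `M_k = t_k^x ∏_j t_{k+j+1}^(x + (j+1)/p − 1)` and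
`Y_k = (1/p)(1 − t_k)(1 − ζ)^(−ps) C M_k ζ^(−px)` on the open cube, each `Y_k` is differentiable and
the diagonal partial derivatives sum to zero. [cite: KontsevichZagier2001, §1.2] -/
theorem cornerFieldGen : ∀ (n : ℕ) (x s : ℚ), 0 < x → 0 < s →
    ∀ (ζt Cf : (Fin (n + 2) → ℝ) → ℝ) (Mt Y : (Fin (n + 2) → ℝ) → Fin (n + 2) → ℝ),
    (∀ t, ζt t = (∏ i, t i) ^ (1 / ((n:ℝ) + 2))) →
    (∀ t, Cf t = ∏ i, (1 - t i) ^ ((s:ℝ) - 1)) →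
    (∀ t k, Mt t k = (t k) ^ (x:ℝ) * ∏ j : Fin (n + 1), (t (k + j.succ)) ^ ((x:ℝ) + (((j:ℕ):ℝ) + 1) / ((n:ℝ) + 2) - 1)) →
    (∀ t k, Y t k = 1 / ((n:ℝ) + 2) * (1 - t k) * (1 - ζt t) ^ (-(((n:ℝ) + 2) * (s:ℝ))) * Cf t * Mt t k *
      ζt t ^ (-(((n:ℝ) + 2) * (x:ℝ)))) →
    ∀ t : Fin (n + 2) → ℝ, (∀ i, t i ∈ Set.Ioo (0:ℝ) 1) →
      (∀ k, DifferentiableAt ℝ (fun t' => Y t' k) t) ∧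
      ∃ d : Fin (n + 2) → ℝ, (∀ k, HasDerivAt (fun a => Y (Function.update t k a) k) (d k) (t k)) ∧
        ∑ k, d k = 0 := by
  intro n x s hx hs ζt Cf Mt Y hζ hC hM hY t ht
  have hp : (0:ℝ) < (n:ℝ) + 2 := by positivity
  have ht0 : ∀ i, 0 < t i := fun i => (ht i).1
  have ht1 : ∀ i, t i < 1 := fun i => (ht i).2
  set p : ℝ := (n:ℝ) + 2 with hpdef
  set T : ℝ := ∏ i, t i with hTdef
  have hT0 : 0 < T := Finset.prod_pos fun i _ => ht0 i
  have hζ0 : 0 < ζt t := by rw [hζ]; exact Real.rpow_pos_of_pos hT0 _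
  have hζ1 : ζt t < 1 := by
    rw [hζ]
    refine Real.rpow_lt_one hT0.le ?_ (by positivity)
    calc T = ∏ i, t i := rfl
      _ < ∏ _i : Fin (n + 2), (1:ℝ) := Finset.prod_lt_prod_of_nonempty (fun i _ => ht0 i) (fun i _ => ht1 i)
          Finset.univ_nonempty
      _ = 1 := by simp
  -- rewrite `Y` as a function: all factors are differentiable at `t`
  have hYfun : ∀ k, (fun t' => Y t' k) = fun t' => 1 / p * (1 - t' k) * (1 - (∏ i, t' i) ^ (1 / p)) ^ (-(p * (s:ℝ))) *
      (∏ i, (1 - t' i) ^ ((s:ℝ) - 1)) *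
      ((t' k) ^ (x:ℝ) * ∏ j : Fin (n + 1), (t' (k + j.succ)) ^ ((x:ℝ) + (((j:ℕ):ℝ) + 1) / p - 1)) *
      ((∏ i, t' i) ^ (1 / p)) ^ (-(p * (x:ℝ))) := by
    intro k; funext t'; rw [hY, hζ, hC, hM]
  have hdiff : ∀ k, DifferentiableAt ℝ (fun t' => Y t' k) t := by
    intro k
    rw [hYfun k]
    have hproj : ∀ i, DifferentiableAt ℝ (fun t' : Fin (n + 2) → ℝ => t' i) t := fun i => differentiableAt_apply i t
    have hprod : DifferentiableAt ℝ (fun t' : Fin (n + 2) → ℝ => ∏ i, t' i) t :=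
      (HasFDerivAt.finsetProd (u := Finset.univ) fun i _ => (hproj i).hasFDerivAt).differentiableAt
    have hz : DifferentiableAt ℝ (fun t' : Fin (n + 2) → ℝ => (∏ i, t' i) ^ (1 / p)) t :=
      hprod.rpow_const (Or.inl hT0.ne')
    have hzt : (∏ i, t i) ^ (1 / p) = ζt t := (hζ t).symm
    refine ((((((differentiableAt_const _).mul ((differentiableAt_const _).sub (hproj k))).mul ?_).mul ?_).mul
      ?_).mul ?_)
    · refine ((differentiableAt_const (1:ℝ)).sub hz).rpow_const (Or.inl ?_)
      show (1:ℝ) - (∏ i, t i) ^ (1 / p) ≠ 0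
      rw [hzt]; linarith
    · refine (HasFDerivAt.finsetProd (u := Finset.univ) fun i _ =>
        (((differentiableAt_const (1:ℝ)).sub (hproj i)).rpow_const (Or.inl ?_)).hasFDerivAt).differentiableAt
      show (1:ℝ) - t i ≠ 0
      linarith [ht1 i]
    · exact ((hproj k).rpow_const (Or.inl (ht0 k).ne')).mul
        (HasFDerivAt.finsetProd (u := Finset.univ) fun j _ =>
          ((hproj _).rpow_const (Or.inl (ht0 _).ne')).hasFDerivAt).differentiableAt
    · exact hz.rpow_const (Or.inl (by rw [hzt]; exact hζ0.ne'))
  refine ⟨hdiff, ?_⟩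
  -- the diagonal slices: closed form `(s/p)·C·(1−ζ)^(−ps−1)/T · ρ_k (ζ − t_k)`
  have hslice : ∀ k, HasDerivAt (fun a => Y (Function.update t k a) k)
      ((s:ℝ) / p * Cf t * (1 - ζt t) ^ (-(p * (s:ℝ)) - 1) / T *
        ((∏ j : Fin (n + 1), t (k + j.succ) ^ ((((j:ℕ):ℝ) + 1) / p)) * (ζt t - t k))) (t k) := by
    intro k
    set T' := ∏ j : Fin (n + 1), t (k + j.succ) with hT'
    set C' := ∏ j : Fin (n + 1), (1 - t (k + j.succ)) ^ ((s:ℝ) - 1) with hC'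
    set Rt := ∏ j : Fin (n + 1), t (k + j.succ) ^ ((x:ℝ) + (((j:ℕ):ℝ) + 1) / p - 1) with hRt
    set ρ := ∏ j : Fin (n + 1), t (k + j.succ) ^ ((((j:ℕ):ℝ) + 1) / p) with hρ
    have hT'0 : 0 < T' := Finset.prod_pos fun j _ => ht0 _
    have hTT : t k * T' = T := mul_prod_add_succ t k
    have hCC : (1 - t k) ^ ((s:ℝ) - 1) * C' = Cf t := by
      rw [hC]; exact mul_prod_add_succ (fun i => (1 - t i) ^ ((s:ℝ) - 1)) k
    have hRρ : Rt = T' ^ ((x:ℝ) - 1) * ρ := by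
      rw [hRt, hρ, hT', ← Real.finsetProd_rpow _ _ (fun j _ => (ht0 _).le), ← Finset.prod_mul_distrib]
      refine Finset.prod_congr rfl fun j _ => ?_
      rw [← Real.rpow_add (ht0 _)]
      congr 1; ring
    have hζT : (t k * T') ^ (1 / p) = ζt t := by rw [hTT, hζ]
    -- the slice is an explicit one-variable function near `t k`
    have hev : (fun a => Y (Function.update t k a) k) =ᶠ[nhds (t k)]
        fun a => (1 / p * C' * Rt * T' ^ (-(x:ℝ))) * ((1 - a) ^ (s:ℝ) * (1 - (a * T') ^ (1 / p)) ^ (-(p * (s:ℝ)))) := by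
      filter_upwards [Ioo_mem_nhds (ht0 k) (ht1 k)] with a ha
      have ha0 : 0 < a := ha.1
      have ha1 : a < 1 := ha.2
      have hupd : ∀ j : Fin (n + 1), Function.update t k a (k + j.succ) = t (k + j.succ) := fun j =>
        Function.update_of_ne (add_succ_ne k j) _ _
      have h1 : ∏ i, Function.update t k a i = a * T' := by
        rw [← mul_prod_add_succ _ k, Function.update_self]
        simp only [hupd, hT']
      have h2 : ∏ i, (1 - Function.update t k a i) ^ ((s:ℝ) - 1) = (1 - a) ^ ((s:ℝ) - 1) * C' := by
        rw [← mul_prod_add_succ _ k, Function.update_self]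
        simp only [hupd, hC']
      have h3 : ∏ j : Fin (n + 1), (Function.update t k a (k + j.succ)) ^ ((x:ℝ) + (((j:ℕ):ℝ) + 1) / p - 1) = Rt := by
        simp only [hupd, hRt]
      rw [hY, hζ, hC, hM, Function.update_self, h1, h2, h3]
      have e1 : ((a * T') ^ (1 / p)) ^ (-(p * (x:ℝ))) = a ^ (-(x:ℝ)) * T' ^ (-(x:ℝ)) := by
        rw [← Real.rpow_mul (by positivity), show 1 / p * -(p * (x:ℝ)) = -(x:ℝ) by field_simp,
          Real.mul_rpow ha0.le hT'0.le]
      have e2 : (1 - a) * (1 - a) ^ ((s:ℝ) - 1) = (1 - a) ^ (s:ℝ) := by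
        have h1a : (0:ℝ) < 1 - a := by linarith
        calc (1 - a) * (1 - a) ^ ((s:ℝ) - 1) = (1 - a) ^ (1:ℝ) * (1 - a) ^ ((s:ℝ) - 1) := by
              rw [Real.rpow_one]
          _ = (1 - a) ^ (s:ℝ) := by rw [← Real.rpow_add h1a]; congr 1; ring
      have e3 : a ^ (x:ℝ) * a ^ (-(x:ℝ)) = 1 := by
        rw [← Real.rpow_add ha0, add_neg_cancel, Real.rpow_zero]
      rw [e1]
      calc 1 / p * (1 - a) * (1 - (a * T') ^ (1 / p)) ^ (-(p * (s:ℝ))) * ((1 - a) ^ ((s:ℝ) - 1) * C') *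
            (a ^ (x:ℝ) * Rt) * (a ^ (-(x:ℝ)) * T' ^ (-(x:ℝ)))
          = (1 / p * C' * Rt * T' ^ (-(x:ℝ))) * (((1 - a) * (1 - a) ^ ((s:ℝ) - 1)) *
              (1 - (a * T') ^ (1 / p)) ^ (-(p * (s:ℝ)))) * (a ^ (x:ℝ) * a ^ (-(x:ℝ))) := by ring
        _ = _ := by rw [e2, e3, mul_one]
    -- differentiate the explicit function
    have hz1 : 1 - ζt t ≠ 0 := by linarith
    have g1 : HasDerivAt (fun a : ℝ => (1 - a) ^ (s:ℝ)) ((-1) * (s:ℝ) * (1 - t k) ^ ((s:ℝ) - 1)) (t k) := by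
      have := ((hasDerivAt_id (t k)).const_sub 1).rpow_const (p := (s:ℝ)) (Or.inl (by simp; linarith [ht1 k]))
      simpa using this
    have g2 : HasDerivAt (fun a : ℝ => (a * T') ^ (1 / p)) (1 * T' * (1 / p) * (t k * T') ^ (1 / p - 1)) (t k) :=
      ((hasDerivAt_id (t k)).mul_const T').rpow_const (Or.inl (by simpa using (mul_pos (ht0 k) hT'0).ne'))
    have g3 : HasDerivAt (fun a : ℝ => (1 - (a * T') ^ (1 / p)) ^ (-(p * (s:ℝ))))
        (-(1 * T' * (1 / p) * (t k * T') ^ (1 / p - 1)) * (-(p * (s:ℝ))) *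
          (1 - (t k * T') ^ (1 / p)) ^ (-(p * (s:ℝ)) - 1)) (t k) :=
      (g2.const_sub 1).rpow_const (Or.inl (by rw [hζT]; exact hz1))
    have g := (g1.mul g3).const_mul (1 / p * C' * Rt * T' ^ (-(x:ℝ)))
    refine (g.congr_of_eventuallyEq hev).congr_deriv ?_
    -- the algebra of the closed form
    rw [hζT]
    have eT : (t k * T') ^ (1 / p - 1) = ζt t / T := by
      rw [Real.rpow_sub (mul_pos (ht0 k) hT'0), Real.rpow_one, hζT, hTT]
    rw [eT, hRρ, ← hCC]
    have ez : (1 - ζt t) ^ (-(p * (s:ℝ))) = (1 - ζt t) ^ (-(p * (s:ℝ)) - 1) * (1 - ζt t) := by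
      rw [← Real.rpow_add_one hz1]; congr 1; ring
    have es : (1 - t k) ^ (s:ℝ) = (1 - t k) ^ ((s:ℝ) - 1) * (1 - t k) := by
      rw [← Real.rpow_add_one (by linarith [ht1 k])]; congr 1; ring
    have ex : T' ^ ((x:ℝ) - 1) * T' ^ (-(x:ℝ)) = 1 / T' := by
      rw [← Real.rpow_add hT'0, show (x:ℝ) - 1 + -(x:ℝ) = -1 by ring, Real.rpow_neg_one, one_div]
    rw [ez, es, ← hTT]
    have hp0 : p ≠ 0 := hp.ne'
    have htk : t k ≠ 0 := (ht0 k).ne'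
    have hT'1 : T' ≠ 0 := hT'0.ne'
    calc 1 / p * C' * (T' ^ ((x:ℝ) - 1) * ρ) * T' ^ (-(x:ℝ)) *
          (-1 * (s:ℝ) * (1 - t k) ^ ((s:ℝ) - 1) * ((1 - ζt t) ^ (-(p * (s:ℝ)) - 1) * (1 - ζt t)) +
            (1 - t k) ^ ((s:ℝ) - 1) * (1 - t k) *
              (-(1 * T' * (1 / p) * (ζt t / (t k * T'))) * -(p * (s:ℝ)) * (1 - ζt t) ^ (-(p * (s:ℝ)) - 1)))
        = (1 / p * C' * ρ * (T' ^ ((x:ℝ) - 1) * T' ^ (-(x:ℝ)))) * ((s:ℝ) * (1 - t k) ^ ((s:ℝ) - 1) *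
            (1 - ζt t) ^ (-(p * (s:ℝ)) - 1)) * (-(1 - ζt t) + (1 - t k) * (T' * (1 / p) * p) * (ζt t / (t k * T'))) := by
          ring
      _ = (s:ℝ) / p * ((1 - t k) ^ ((s:ℝ) - 1) * C') * (1 - ζt t) ^ (-(p * (s:ℝ)) - 1) / (t k * T') *
            (ρ * (ζt t - t k)) := by
          rw [ex]
          field_simp
          ring
  refine ⟨fun k => (s:ℝ) / p * Cf t * (1 - ζt t) ^ (-(p * (s:ℝ)) - 1) / T *
      ((∏ j : Fin (n + 1), t (k + j.succ) ^ ((((j:ℕ):ℝ) + 1) / p)) * (ζt t - t k)), hslice, ?_⟩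
  rw [← Finset.mul_sum, hζ]
  simp only [hpdef]
  rw [sum_rho_mul_sub t ht0, mul_zero]


end Summit.KontsevichZagierPeriods.TerasomaMultiplication.MultiplicationAccessible
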